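/- Fleet lead `ym-wcr-19456-p1`, route `WeakCouplingRates`, crux `ColdBoxTwoPointFloorW` (stmt-QuantumFields-19608). -/
import Summits.QuantumFields.YangMills.Theorems.WeakCouplingRatesColdBoxChartDict
import Literature.MathematicalPhysics.QuantumFieldTheory.GaussianToolkit
import Literature.MathematicalPhysics.QuantumFieldTheory.SU2OneLinkIntegrals

/-!
# Crux `ColdBoxTwoPointFloor(W)`, assembly step (a): the PRODUCT of gnomonic charts — product Haar on `SU(2)^ι` restricted to
# «all links in the upper hemisphere» is the chart image of the product gnomonic density on `(ℝ³)^ι`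

* `upperHemisphere = {U : 0 < Re tr U}`, `gnomonicChart v = P(1,v)` (lands in it: `gnomonicChart_mem_upper`),
  `gnomonicDensity v = (2π²)⁻¹(1+|v|²)⁻²`; measurability;
* `haar_restrict_upper_eq_map` — **single link**: `Haar|_{upper} = (gnomonicDensity·Leb)∘(gnomonicChart)⁻¹` as MEASURES (from the
  upper-hemisphere formula `lintegral_haarProbability_su2_gnomonic_upper` of `…ColdBoxChartDict`);
* `pi_haar_restrict_upper_eq_map` — **product of links** (`Measure.restrict_pi_pi`, `Measure.pi_map_pi`, the tree's
  `GaussianToolkit.pi_withDensity`);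
* **`lintegral_pi_haar_eq_gnomonic`** — for measurable `Φ ≥ 0` on `SU(2)^ι` vanishing as soon as some link has `Re tr ≤ 0`:
  `∫ Φ dHaar^{⊗ι} = ∫_{(ℝ³)^ι} Φ((P(1,v_e))_e) ∏_e (2π²)⁻¹(1+|v_e|²)⁻² dv`.
Use: `ι` = the free edges (`ColdFreeCfg H` index ≃ `DirFree H`), `Φ` = the integrand of `integral_boxState_eq_coldFree` times the small-field
indicator (which forces every gauge-fixed link into the upper hemisphere by `ell_le_uniform`); then the chart-side integrand is the Gaussian
weight `exp(−β Σ|s_p(v)|²)` times the tilt of `…ColdBoxCubic`/`…ChartDict` (steps (b)–(d) of PLAN-S3c-ii).  Everything proved; the three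
`def`s are the chart objects; standard axioms.
-/

set_option autoImplicit false

noncomputable section

open MeasureTheory Quaternion
open scoped ENNReal
open Literature.MathematicalPhysics.QuantumLattice
open Literature.MathematicalPhysics.QuantumFieldTheory

namespace Summit.QuantumFields.YangMills.Theorems.WeakCouplingRates

/-- The upper hemisphere `{U ∈ SU(2) : 0 < Re tr U}` (links near the identity). -/
def upperHemisphere : Set (Matrix.specialUnitaryGroup (Fin 2) ℂ) :=
  {U | 0 < ((U : Matrix (Fin 2) (Fin 2) ℂ).trace).re}

/-- The gnomonic chart `v ↦ P(1, v)`. -/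
def gnomonicChart (v : Fin 3 → ℝ) : Matrix.specialUnitaryGroup (Fin 2) ℂ := quatToSU2 (gnomonicQuat v)

/-- The gnomonic Haar density `(2π²)⁻¹ (1 + |v|²)⁻²` on `ℝ³`. -/
def gnomonicDensity (v : Fin 3 → ℝ) : ℝ≥0∞ :=
  ENNReal.ofReal (1 / (2 * Real.pi ^ 2)) * ENNReal.ofReal (((1 + ∑ i, v i ^ 2)⁻¹) ^ 2)

/-- The upper hemisphere is measurable. -/
theorem measurableSet_upperHemisphere : MeasurableSet upperHemisphere :=
  measurableSet_lt measurable_const SU2OneLink.measurable_re_trace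

/-- The gnomonic chart is measurable. -/
theorem measurable_gnomonicChart : Measurable gnomonicChart := measurable_quatToSU2.comp measurable_gnomonicQuat

/-- The gnomonic density is measurable. -/
theorem measurable_gnomonicDensity : Measurable gnomonicDensity := by
  unfold gnomonicDensity
  refine measurable_const.mul (ENNReal.measurable_ofReal.comp ?_)
  exact ((measurable_const.add (Finset.measurable_sum _ fun i _ => (measurable_pi_apply i).pow_const 2)).inv).pow_const 2

/-- The chart lands in the upper hemisphere. -/
theorem gnomonicChart_mem_upper (v : Fin 3 → ℝ) : gnomonicChart v ∈ upperHemisphere := by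
  unfold upperHemisphere gnomonicChart
  rw [Set.mem_setOf_eq]
  have h := two_sub_trace_re_gnomonic v
  have : 0 < Real.sqrt (1 + ∑ i, v i ^ 2) := Real.sqrt_pos.2 (by positivity)
  have : 0 < 2 / Real.sqrt (1 + ∑ i, v i ^ 2) := by positivity
  linarith

/-- **Single link**: Haar on `SU(2)` restricted to the upper hemisphere is the chart image of the gnomonic density. -/
theorem haar_restrict_upper_eq_map :
    (haarProbability (Matrix.specialUnitaryGroup (Fin 2) ℂ)).restrict upperHemisphere =
      ((volume : Measure (Fin 3 → ℝ)).withDensity gnomonicDensity).map gnomonicChart := by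
  refine Measure.ext fun s hs => ?_
  have hsm : MeasurableSet (s ∩ upperHemisphere) := hs.inter measurableSet_upperHemisphere
  have key := lintegral_haarProbability_su2_gnomonic_upper ((s ∩ upperHemisphere).indicator 1) (measurable_one.indicator hsm)
    (fun U hU => Set.indicator_of_notMem (fun h => absurd h.2 (not_lt.2 hU)) _)
  rw [Measure.restrict_apply hs, Measure.map_apply measurable_gnomonicChart hs,
    withDensity_apply _ (measurable_gnomonicChart hs), ← lintegral_indicator_one hsm, key,
    ← lintegral_indicator (measurable_gnomonicChart hs),
    ← lintegral_const_mul' _ _ ENNReal.ofReal_ne_top]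
  refine lintegral_congr fun v => ?_
  by_cases hv : gnomonicChart v ∈ s
  · have hmem : quatToSU2 (gnomonicQuat v) ∈ s ∩ upperHemisphere := ⟨hv, gnomonicChart_mem_upper v⟩
    rw [Set.indicator_of_mem hmem, Set.indicator_of_mem (show v ∈ gnomonicChart ⁻¹' s from hv)]
    simp [gnomonicDensity]
  · have hnmem : quatToSU2 (gnomonicQuat v) ∉ s ∩ upperHemisphere := fun h => hv h.1
    rw [Set.indicator_of_notMem hnmem, Set.indicator_of_notMem (show v ∉ gnomonicChart ⁻¹' s from hv)]
    simp

/-- The gnomonic density is finite everywhere. -/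
theorem gnomonicDensity_ne_top (v : Fin 3 → ℝ) : gnomonicDensity v ≠ ∞ := by
  unfold gnomonicDensity; exact ENNReal.mul_ne_top ENNReal.ofReal_ne_top ENNReal.ofReal_ne_top

/-- **Product of links**: product Haar on `SU(2)^ι` restricted to «every link in the upper hemisphere» is the image under the
product chart of the product gnomonic density on `(ℝ³)^ι`. -/
theorem pi_haar_restrict_upper_eq_map (ι : Type*) [Fintype ι] :
    (Measure.pi fun _ : ι => haarProbability (Matrix.specialUnitaryGroup (Fin 2) ℂ)).restrict
        (Set.univ.pi fun _ : ι => upperHemisphere) =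
      ((Measure.pi fun _ : ι => (volume : Measure (Fin 3 → ℝ))).withDensity fun v => ∏ e, gnomonicDensity (v e)).map
        (fun v e => gnomonicChart (v e)) := by
  haveI hσ : SigmaFinite ((volume : Measure (Fin 3 → ℝ)).withDensity gnomonicDensity) :=
    SigmaFinite.withDensity_of_ne_top' gnomonicDensity_ne_top
  have hsf : ∀ _i : ι, SigmaFinite (((volume : Measure (Fin 3 → ℝ)).withDensity gnomonicDensity).map gnomonicChart) :=
    fun _ => by rw [← haar_restrict_upper_eq_map]; infer_instance
  rw [Measure.restrict_pi_pi]
  simp_rw [haar_restrict_upper_eq_map]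
  rw [← Measure.pi_map_pi (hμ := hsf) (fun _ => measurable_gnomonicChart.aemeasurable),
    GaussianToolkit.pi_withDensity _ _ (fun _ => measurable_gnomonicDensity)]

/-- **Product chart formula**: for a measurable `Φ ≥ 0` on `SU(2)^ι` vanishing as soon as some link has `Re tr ≤ 0`,
`∫ Φ dHaar^{⊗ι} = ∫_{(ℝ³)^ι} Φ(P(1,v_e))_e · ∏_e (2π²)⁻¹(1+|v_e|²)⁻² dv` — step (a) of the assembly of the one-scale expansion (apply with
`ι` = the free edges `ColdFreeCfg`, `Φ` = the integrand of `integral_boxState_eq_coldFree` times the small-field indicator). -/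
theorem lintegral_pi_haar_eq_gnomonic {ι : Type*} [Fintype ι]
    (Φ : (ι → Matrix.specialUnitaryGroup (Fin 2) ℂ) → ℝ≥0∞) (hΦ : Measurable Φ)
    (hsupp : ∀ U : ι → Matrix.specialUnitaryGroup (Fin 2) ℂ,
      (∃ e, (((U e : Matrix.specialUnitaryGroup (Fin 2) ℂ) : Matrix (Fin 2) (Fin 2) ℂ).trace).re ≤ 0) → Φ U = 0) :
    ∫⁻ U, Φ U ∂(Measure.pi fun _ : ι => haarProbability (Matrix.specialUnitaryGroup (Fin 2) ℂ)) =
      ∫⁻ v : ι → (Fin 3 → ℝ), Φ (fun e => gnomonicChart (v e)) * ∏ e, gnomonicDensity (v e)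
        ∂(Measure.pi fun _ : ι => (volume : Measure (Fin 3 → ℝ))) := by
  set S : Set (ι → Matrix.specialUnitaryGroup (Fin 2) ℂ) := Set.univ.pi fun _ : ι => upperHemisphere with hS
  have hSm : MeasurableSet S := MeasurableSet.univ_pi fun _ => measurableSet_upperHemisphere
  have hind : Φ = S.indicator Φ := by
    funext U
    by_cases hU : U ∈ S
    · rw [Set.indicator_of_mem hU]
    · rw [Set.indicator_of_notMem hU]
      apply hsupp
      simp only [hS, Set.mem_univ_pi, not_forall] at hU
      obtain ⟨e, he⟩ := hU
      exact ⟨e, not_lt.1 he⟩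
  have hchart : Measurable fun (v : ι → (Fin 3 → ℝ)) (e : ι) => gnomonicChart (v e) :=
    measurable_pi_lambda _ fun e => measurable_gnomonicChart.comp (measurable_pi_apply e)
  have hdens : Measurable fun v : ι → (Fin 3 → ℝ) => ∏ e, gnomonicDensity (v e) :=
    Finset.measurable_prod _ fun e _ => measurable_gnomonicDensity.comp (measurable_pi_apply e)
  have h3 := lintegral_withDensity_eq_lintegral_mul (Measure.pi fun _ : ι => (volume : Measure (Fin 3 → ℝ))) hdens
    (hΦ.comp hchart)
  simp only [Function.comp_def, Pi.mul_apply] at h3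
  conv_lhs => rw [hind]
  rw [lintegral_indicator hSm, pi_haar_restrict_upper_eq_map ι, lintegral_map hΦ hchart, h3]
  refine lintegral_congr fun v => ?_
  rw [mul_comm]

end Summit.QuantumFields.YangMills.Theorems.WeakCouplingRates

end
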